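import Summits.Ventures.PercRepro.SixThreeDemand3
import Summits.Ventures.PercRepro.SixThreeClassify

/-!
# PercRepro — the type-`3` demand of a union of two lines (p2, gen 6)

mine-2 `MINE2-RLS.md` §19.7 Step 2: when `G = (L₁ ∩ G) ∪ (L₂ ∩ G)` is a union of two lines (and not line + point,
`g ≥ 5`), the only sets `Z ⊆ L ∩ G` (`|Z| ≥ 2`) with `ρ(G ∖ Z) ≤ 2` are, for `L ∈ {L₁, L₂}`, the sets containing
`(L ∩ G) ∖ L′` (`L′` the other line): `Z = L ∩ G` or `Z = (L ∩ G) ∖ {c}` with `c` the meeting point.  Hence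
`Σ_L #badZ(L) ≤ 2 · 2^{|L₁ ∩ L₂ ∩ G|}` (`= 4` meeting, `= 2` disjoint), and with `demand3_add_C2gen_le`
the type-`3` demand is at most `N₃ − C2gen + 4` resp. `+ 2` — mine-2's `(T4)` / `(T5)` corrections.
* `twoLines_of_badZ`: a bad `Z ⊆ L ∩ G` yields a line `L′ ⊇ G ∖ Z` with `G ⊆ L ∪ L′`, `L ≠ L′`, `(L ∩ G) ∖ L′ ⊆ Z`;
* `twoLines_unique`: the decomposition is unique (`g ≥ 5`, no line through `g − 1` points);
* `sum_badZ_le_twoLines`: the bound.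
-/

namespace PercRepro

namespace SixThree

open Finset ThmH

variable {α : Type*} [DecidableEq α] {M : Matroid α} [M.Finite]

/-- `G` is the union of the traces of two distinct lines. -/
def TwoLines (M : Matroid α) [M.Finite] (G L₁ L₂ : Finset α) : Prop :=
  L₁ ∈ linesOf M G ∧ L₂ ∈ linesOf M G ∧ L₁ ≠ L₂ ∧ G ⊆ L₁ ∪ L₂

/-- A bad `Z ⊆ L ∩ G` (`|Z| ≥ 2`, `ρ(G ∖ Z) ≤ 2`) on a plane with no line through `≥ g − 1` points gives the second line. -/
theorem twoLines_of_badZ (hs : Simple M) {G L Z : Finset α} (hG : G ∈ planes M) (hL : L ∈ linesOf M G)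
    (hnl : ∀ L ∈ linesOf M G, (L ∩ G).card + 2 ≤ G.card) (hZ : Z ∈ badZ M G L) :
    ∃ L' ∈ linesOf M G, L ≠ L' ∧ G ⊆ L ∪ L' ∧ (L ∩ G) \ L' ⊆ Z := by
  have hGg : G ⊆ gr M := (mem_planes.1 hG).1
  have hG3 := (mem_planes.1 hG).2.2
  unfold badZ at hZ
  rw [Finset.mem_filter, Finset.mem_powerset] at hZ
  obtain ⟨hZLG, hZ2, hZr⟩ := hZ
  have hZG : Z ⊆ G := hZLG.trans Finset.inter_subset_right
  -- `|G ∖ Z| ≥ 2`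
  have hGZ : 2 ≤ (G \ Z).card := by
    have h1 := Finset.card_sdiff_of_subset hZG
    have h2 : Z.card ≤ (L ∩ G).card := Finset.card_le_card hZLG
    have h3 := hnl L hL
    omega
  -- `ρ(G ∖ Z) = 2`
  have hr2 : M.eRk ((G \ Z : Finset α) : Set α) = 2 := by
    have hle : M.eRk ((G \ Z : Finset α) : Set α) ≤ 3 := by
      rw [← hG3]; exact M.eRk_mono (Finset.coe_subset.2 Finset.sdiff_subset)
    obtain ⟨u, hu, v, hv, huv⟩ := Finset.one_lt_card.1 hGZ
    have hge := two_le_eRk_of_two_mem hs (Finset.sdiff_subset.trans hGg) hu hv huv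
    obtain ⟨k, hk, -⟩ := eRk_eq_nat M (G \ Z)
    rw [hk] at hle hZr hge ⊢
    have hk3 : k ≤ 3 := by exact_mod_cast hle
    have hk2 : 2 ≤ k := by exact_mod_cast hge
    have hk3' : k ≠ 3 := fun h => hZr (by rw [h]; rfl)
    exact_mod_cast (show k = 2 by omega)
  obtain ⟨hL', hsub⟩ := clF_mem_lines (Finset.sdiff_subset.trans hGg) hr2
  refine ⟨clF M (G \ Z), ?_, ?_, ?_, ?_⟩
  · unfold linesOf
    rw [Finset.mem_filter]
    exact ⟨hL', hGZ.trans (Finset.card_le_card (Finset.subset_inter hsub Finset.sdiff_subset))⟩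
  · -- `L ≠ L′`: otherwise `G ⊆ L`
    intro heq
    have hGL : G ⊆ L := by
      intro y hy
      by_cases hyZ : y ∈ Z
      · exact (Finset.mem_inter.1 (hZLG hyZ)).1
      · rw [heq]; exact hsub (Finset.mem_sdiff.2 ⟨hy, hyZ⟩)
    have := M.eRk_mono (Finset.coe_subset.2 hGL)
    rw [hG3, (mem_lines.1 (Finset.mem_filter.1 hL).1).2.2] at this
    exact absurd this (by decide)
  · intro y hy
    rw [Finset.mem_union]
    by_cases hyZ : y ∈ Z
    · exact Or.inl (Finset.mem_inter.1 (hZLG hyZ)).1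
    · exact Or.inr (hsub (Finset.mem_sdiff.2 ⟨hy, hyZ⟩))
  · intro y hy
    rw [Finset.mem_sdiff, Finset.mem_inter] at hy
    by_contra hyZ
    exact hy.2 (hsub (Finset.mem_sdiff.2 ⟨hy.1.2, hyZ⟩))

/-- **Uniqueness of the two-line decomposition** (`g ≥ 5`, every line has `≤ g − 2` points): if `G ⊆ L₁ ∪ L₂` and
`G ⊆ L₃ ∪ L₄` with `L₁ ≠ L₂`, `L₃ ≠ L₄` all lines of `M|G`, then `{L₃, L₄} = {L₁, L₂}`. -/
theorem twoLines_unique (hs : Simple M) {G L₁ L₂ L₃ L₄ : Finset α} (hg5 : 5 ≤ G.card)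
    (hnl : ∀ L ∈ linesOf M G, (L ∩ G).card + 2 ≤ G.card) (h12 : TwoLines M G L₁ L₂) (h34 : TwoLines M G L₃ L₄) :
    (L₃ = L₁ ∧ L₄ = L₂) ∨ (L₃ = L₂ ∧ L₄ = L₁) := by
  obtain ⟨hL₁, hL₂, hne12, hcov12⟩ := h12
  obtain ⟨hL₃, hL₄, hne34, hcov34⟩ := h34
  -- one line of the first pair has `≥ 3` points of `G`: then one line of the second pair contains two of them
  have key : ∀ {A B C D : Finset α}, A ∈ linesOf M G → B ∈ linesOf M G → C ∈ linesOf M G → D ∈ linesOf M G →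
      A ≠ B → C ≠ D → G ⊆ A ∪ B → G ⊆ C ∪ D → 3 ≤ (A ∩ G).card → (C = A ∧ D = B) ∨ (C = B ∧ D = A) := by
    intro A B C D hA hB hC hD hAB hCD hcovAB hcovCD h3
    -- `A ∩ G ⊆ C ∪ D`: one of them has two points of `A ∩ G`
    have hsplit : (A ∩ G).card ≤ ((A ∩ G).filter (fun y => y ∈ C)).card + ((A ∩ G).filter (fun y => y ∉ C)).card := by
      have := Finset.card_filter_add_card_filter_not (s := A ∩ G) (p := fun y => y ∈ C)
      omega
    have hD' : ((A ∩ G).filter (fun y => y ∉ C)) ⊆ D ∩ G := by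
      intro y hy
      rw [Finset.mem_filter, Finset.mem_inter] at hy
      have := hcovCD hy.1.2
      rw [Finset.mem_union] at this
      rw [Finset.mem_inter]
      rcases this with h | h
      · exact absurd h hy.2
      · exact ⟨h, hy.1.2⟩
    -- a line containing two points of `A ∩ G` equals `A`
    have heqA : ∀ {E : Finset α}, E ∈ linesOf M G → 2 ≤ ((A ∩ G).filter (fun y => y ∈ E)).card → E = A := by
      intro E hE h2
      obtain ⟨u, hu, v, hv, huv⟩ := Finset.one_lt_card.1 h2
      rw [Finset.mem_filter, Finset.mem_inter] at hu hv
      exact lines_eq_of_two_mem hs (Finset.mem_filter.1 hE).1 (Finset.mem_filter.1 hA).1 hu.2 hv.2 hu.1.1 hv.1.1 huv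
    -- the complement `G ∖ A` has `≥ 2` points and lies in `B`; whichever of `C, D` is `A`, the other contains it
    have hGA : 2 ≤ (G \ A).card := by
      have h := Finset.card_sdiff_add_card_inter G A
      rw [Finset.inter_comm] at h
      have := hnl A hA
      omega
    have hGAB : G \ A ⊆ B := by
      intro y hy
      rw [Finset.mem_sdiff] at hy
      have := hcovAB hy.1
      rw [Finset.mem_union] at this
      rcases this with h | h
      · exact absurd h hy.2
      · exact h
    have hother : ∀ {E : Finset α}, E ∈ linesOf M G → G \ A ⊆ E → E = B := by
      intro E hE hsub
      obtain ⟨u, hu, v, hv, huv⟩ := Finset.one_lt_card.1 hGA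
      exact lines_eq_of_two_mem hs (Finset.mem_filter.1 hE).1 (Finset.mem_filter.1 hB).1 (hsub hu) (hsub hv)
        (hGAB hu) (hGAB hv) huv
    by_cases hCbig : 2 ≤ ((A ∩ G).filter (fun y => y ∈ C)).card
    · have hCA := heqA hC hCbig
      left
      refine ⟨hCA, hother hD ?_⟩
      intro y hy
      rw [Finset.mem_sdiff] at hy
      have := hcovCD hy.1
      rw [Finset.mem_union] at this
      rcases this with h | h
      · exact absurd (hCA ▸ h) hy.2
      · exact h
    · have hDbig : 2 ≤ ((A ∩ G).filter (fun y => y ∉ C)).card := by omega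
      have hDA : D = A := by
        apply heqA hD
        have : (A ∩ G).filter (fun y => y ∉ C) ⊆ (A ∩ G).filter (fun y => y ∈ D) := by
          intro y hy
          have hyD := hD' hy
          rw [Finset.mem_filter] at hy ⊢
          exact ⟨hy.1, (Finset.mem_inter.1 hyD).1⟩
        exact hDbig.trans (Finset.card_le_card this)
      right
      refine ⟨hother hC ?_, hDA⟩
      intro y hy
      rw [Finset.mem_sdiff] at hy
      have := hcovCD hy.1
      rw [Finset.mem_union] at this
      rcases this with h | h
      · exact h
      · exact absurd (hDA ▸ h) hy.2
  -- one of `L₁, L₂` has `≥ 3` points of `G`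
  have hcount : G.card ≤ (L₁ ∩ G).card + (L₂ ∩ G).card := by
    have : G ⊆ (L₁ ∩ G) ∪ (L₂ ∩ G) := by
      intro y hy
      have := hcov12 hy
      rw [Finset.mem_union] at this ⊢
      rw [Finset.mem_inter, Finset.mem_inter]
      rcases this with h | h
      · exact Or.inl ⟨h, hy⟩
      · exact Or.inr ⟨h, hy⟩
    exact (Finset.card_le_card this).trans (Finset.card_union_le _ _)
  by_cases h3 : 3 ≤ (L₁ ∩ G).card
  · exact key hL₁ hL₂ hL₃ hL₄ hne12 hne34 hcov12 hcov34 h3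
  · have h3' : 3 ≤ (L₂ ∩ G).card := by omega
    have hcov21 : G ⊆ L₂ ∪ L₁ := by rw [Finset.union_comm]; exact hcov12
    rcases key hL₂ hL₁ hL₃ hL₄ (Ne.symm hne12) hne34 hcov21 hcov34 h3' with ⟨h1, h2⟩ | ⟨h1, h2⟩
    · exact Or.inr ⟨h1, h2⟩
    · exact Or.inl ⟨h1, h2⟩

/-- On a two-line plane (`g ≥ 5`, every line `≤ g − 2` points) a bad `Z ⊆ L ∩ G` forces `L ∈ {L₁, L₂}` and
`(L ∩ G) ∖ L' ⊆ Z` for the other line `L'`. -/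
theorem badZ_structure (hs : Simple M) {G L₁ L₂ L Z : Finset α} (hG : G ∈ planes M) (hg5 : 5 ≤ G.card)
    (hnl : ∀ L ∈ linesOf M G, (L ∩ G).card + 2 ≤ G.card) (h12 : TwoLines M G L₁ L₂) (hL : L ∈ linesOf M G)
    (hZ : Z ∈ badZ M G L) :
    (L = L₁ ∧ (L₁ ∩ G) \ L₂ ⊆ Z) ∨ (L = L₂ ∧ (L₂ ∩ G) \ L₁ ⊆ Z) := by
  obtain ⟨L', hL', hne, hcov, hsub⟩ := twoLines_of_badZ hs hG hL hnl hZ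
  have h : TwoLines M G L L' := ⟨hL, hL', hne, hcov⟩
  rcases twoLines_unique hs hg5 hnl h12 h with ⟨h1, h2⟩ | ⟨h1, h2⟩
  · left; subst h1; subst h2; exact ⟨rfl, hsub⟩
  · right; subst h1; subst h2; exact ⟨rfl, hsub⟩

/-- `#badZ(L₁) ≤ 2^{|L₁ ∩ L₂ ∩ G|}` on a two-line plane: a bad `Z` is `((L₁ ∩ G) ∖ L₂) ∪ W`, `W ⊆ L₁ ∩ L₂ ∩ G`. -/
theorem card_badZ_le (hs : Simple M) {G L₁ L₂ : Finset α} (hG : G ∈ planes M) (hg5 : 5 ≤ G.card)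
    (hnl : ∀ L ∈ linesOf M G, (L ∩ G).card + 2 ≤ G.card) (h12 : TwoLines M G L₁ L₂) :
    (badZ M G L₁).card ≤ 2 ^ (L₁ ∩ L₂ ∩ G).card := by
  rw [← Finset.card_powerset]
  apply Finset.card_le_card_of_injOn (fun Z => Z ∩ L₂)
  · intro Z hZ
    rw [Finset.mem_coe] at hZ
    have hZ' := hZ
    unfold badZ at hZ'
    rw [Finset.mem_filter, Finset.mem_powerset] at hZ'
    rw [Finset.mem_coe, Finset.mem_powerset]
    intro y hy
    rw [Finset.mem_inter] at hy
    have := hZ'.1 hy.1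
    rw [Finset.mem_inter] at this
    rw [Finset.mem_inter, Finset.mem_inter]
    exact ⟨⟨this.1, hy.2⟩, this.2⟩
  · intro Z hZ Z' hZ' h
    rw [Finset.mem_coe] at hZ hZ'
    simp only at h
    rcases badZ_structure hs hG hg5 hnl h12 h12.1 hZ with ⟨-, hsub⟩ | ⟨heq, -⟩
    · rcases badZ_structure hs hG hg5 hnl h12 h12.1 hZ' with ⟨-, hsub'⟩ | ⟨heq', -⟩
      · -- `Z = ((L₁ ∩ G) ∖ L₂) ∪ (Z ∩ L₂)`, same for `Z'`
        have hZLG : Z ⊆ L₁ ∩ G := by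
          unfold badZ at hZ; rw [Finset.mem_filter, Finset.mem_powerset] at hZ; exact hZ.1
        have hZ'LG : Z' ⊆ L₁ ∩ G := by
          unfold badZ at hZ'; rw [Finset.mem_filter, Finset.mem_powerset] at hZ'; exact hZ'.1
        ext y
        constructor
        · intro hy
          by_cases hyL₂ : y ∈ L₂
          · have : y ∈ Z' ∩ L₂ := by rw [← h]; exact Finset.mem_inter.2 ⟨hy, hyL₂⟩
            exact (Finset.mem_inter.1 this).1
          · exact hsub' (Finset.mem_sdiff.2 ⟨hZLG hy, hyL₂⟩)
        · intro hy
          by_cases hyL₂ : y ∈ L₂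
          · have : y ∈ Z ∩ L₂ := by rw [h]; exact Finset.mem_inter.2 ⟨hy, hyL₂⟩
            exact (Finset.mem_inter.1 this).1
          · exact hsub (Finset.mem_sdiff.2 ⟨hZ'LG hy, hyL₂⟩)
      · exact absurd heq' h12.2.2.1
    · exact absurd heq h12.2.2.1

/-- `badZ(L) = ∅` for a line `L ∉ {L₁, L₂}` of a two-line plane. -/
theorem badZ_eq_empty (hs : Simple M) {G L₁ L₂ L : Finset α} (hG : G ∈ planes M) (hg5 : 5 ≤ G.card)
    (hnl : ∀ L ∈ linesOf M G, (L ∩ G).card + 2 ≤ G.card) (h12 : TwoLines M G L₁ L₂) (hL : L ∈ linesOf M G)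
    (hne1 : L ≠ L₁) (hne2 : L ≠ L₂) : badZ M G L = ∅ := by
  rw [Finset.eq_empty_iff_forall_notMem]
  intro Z hZ
  rcases badZ_structure hs hG hg5 hnl h12 hL hZ with ⟨h, -⟩ | ⟨h, -⟩
  · exact hne1 h
  · exact hne2 h

/-- `TwoLines` is symmetric. -/
theorem TwoLines.symm {G L₁ L₂ : Finset α} (h : TwoLines M G L₁ L₂) : TwoLines M G L₂ L₁ :=
  ⟨h.2.1, h.1, Ne.symm h.2.2.1, by rw [Finset.union_comm]; exact h.2.2.2⟩

/-- **The bad-`Z` count of a two-line plane**: `Σ_L #badZ(L) ≤ 2 · 2^{|L₁ ∩ L₂ ∩ G|}`. -/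
theorem sum_badZ_le_twoLines (hs : Simple M) {G L₁ L₂ : Finset α} (hG : G ∈ planes M) (hg5 : 5 ≤ G.card)
    (hnl : ∀ L ∈ linesOf M G, (L ∩ G).card + 2 ≤ G.card) (h12 : TwoLines M G L₁ L₂) :
    ∑ L ∈ linesOf M G, (badZ M G L).card ≤ 2 * 2 ^ (L₁ ∩ L₂ ∩ G).card := by
  classical
  have hsub : ({L₁, L₂} : Finset (Finset α)) ⊆ linesOf M G := by
    intro L hL
    simp only [Finset.mem_insert, Finset.mem_singleton] at hL
    rcases hL with rfl | rfl
    · exact h12.1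
    · exact h12.2.1
  rw [← Finset.sum_subset hsub (fun L hL hL' => by
    simp only [Finset.mem_insert, Finset.mem_singleton, not_or] at hL'
    rw [badZ_eq_empty hs hG hg5 hnl h12 hL hL'.1 hL'.2, Finset.card_empty])]
  rw [Finset.sum_pair h12.2.2.1]
  have h1 := card_badZ_le hs hG hg5 hnl h12
  have h2 := card_badZ_le hs hG hg5 hnl h12.symm
  have heq : (L₂ ∩ L₁ ∩ G).card = (L₁ ∩ L₂ ∩ G).card := by rw [Finset.inter_comm L₂ L₁]
  rw [heq] at h2
  omega

/-- **The type-`3` demand of a two-line plane** (`g ≥ 5`, every line `≤ g − 2` points):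
`demand₃ + C2gen g (prof G) ≤ N₃ + 2 · 2^{|L₁ ∩ L₂ ∩ G|}` — mine-2's `−4` (meeting) / `−2` (disjoint). -/
theorem demand3_le_twoLines (hs : Simple M) {G L₁ L₂ : Finset α} (hG : G ∈ planes M) (hg5 : 5 ≤ G.card)
    (hnl : ∀ L ∈ linesOf M G, (L ∩ G).card + 2 ≤ G.card) (h12 : TwoLines M G L₁ L₂) :
    ((R3 M G).filter (fun B : Finset α => M.eRk ((G \ B : Finset α) : Set α) = 3)).card +
      C2gen G.card (prof M G) ≤ (R3 M G).card + 2 * 2 ^ (L₁ ∩ L₂ ∩ G).card := by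
  have h := demand3_add_C2gen_le hs hG (by omega) (fun L hL => by have := hnl L hL; omega)
  have h' := sum_badZ_le_twoLines hs hG hg5 hnl h12
  omega

/-- **Two distinct lines of `M|G` meet in at most one point of `G`**, so the correction is `≤ 4`. -/
theorem demand3_le_twoLines_four (hs : Simple M) {G L₁ L₂ : Finset α} (hG : G ∈ planes M) (hg5 : 5 ≤ G.card)
    (hnl : ∀ L ∈ linesOf M G, (L ∩ G).card + 2 ≤ G.card) (h12 : TwoLines M G L₁ L₂) :
    ((R3 M G).filter (fun B : Finset α => M.eRk ((G \ B : Finset α) : Set α) = 3)).card +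
      C2gen G.card (prof M G) ≤ (R3 M G).card + 4 := by
  have h := demand3_le_twoLines hs hG hg5 hnl h12
  have hc := card_inter_inter_le_one hs h12.1 h12.2.1 h12.2.2.1
  have : 2 ^ (L₁ ∩ L₂ ∩ G).card ≤ 2 := by
    calc 2 ^ (L₁ ∩ L₂ ∩ G).card ≤ 2 ^ 1 := Nat.pow_le_pow_right (by norm_num) hc
      _ = 2 := by norm_num
  omega

/-- The type-`3` demand of a `4`-point plane is `0` (`|G ∖ B| ≤ 1` for every `B ∈ R₃`). -/
theorem demand3_eq_zero_of_four {G : Finset α} (hg4 : G.card = 4) :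
    ((R3 M G).filter (fun B : Finset α => M.eRk ((G \ B : Finset α) : Set α) = 3)).card = 0 := by
  rw [Finset.card_eq_zero, Finset.filter_eq_empty_iff]
  intro B hB h3
  unfold R3 at hB
  rw [Finset.mem_filter, Finset.mem_powerset] at hB
  have h1 : (G \ B).card ≤ 1 := by
    have := Finset.card_sdiff_of_subset hB.1
    have := three_le_card_of_eRk_eq_three hB.2
    omega
  have := M.eRk_le_encard ((G \ B : Finset α) : Set α)
  rw [h3, Set.encard_coe_eq_coe_finsetCard] at this
  have h1' : ((G \ B).card : ℕ∞) ≤ 1 := by exact_mod_cast h1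
  have := this.trans h1'
  exact absurd this (by decide)

/-- **The type-`3` demand, all cases** (`g ≥ 4`): either it is `0` (line + point, or `g = 4`), or the plane is not a
union of two lines and `demand₃ + C2gen ≤ N₃`, or it is a union of two lines `L₁, L₂` (`g ≥ 5`, every line
`≤ g − 2` points) and `demand₃ + C2gen ≤ N₃ + 2 · 2^{|L₁ ∩ L₂ ∩ G|}`. -/
theorem demand3_cases (hs : Simple M) {G : Finset α} (hG : G ∈ planes M) (hg4 : 4 ≤ G.card) :
    ((R3 M G).filter (fun B : Finset α => M.eRk ((G \ B : Finset α) : Set α) = 3)).card = 0 ∨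
    ((∀ L ∈ linesOf M G, M.eRk ((G \ L : Finset α) : Set α) = 3) ∧
      ((R3 M G).filter (fun B : Finset α => M.eRk ((G \ B : Finset α) : Set α) = 3)).card +
        C2gen G.card (prof M G) ≤ (R3 M G).card) ∨
    ∃ L₁ L₂, TwoLines M G L₁ L₂ ∧ 5 ≤ G.card ∧ (∀ L ∈ linesOf M G, (L ∩ G).card + 2 ≤ G.card) ∧
      ((R3 M G).filter (fun B : Finset α => M.eRk ((G \ B : Finset α) : Set α) = 3)).card +
        C2gen G.card (prof M G) ≤ (R3 M G).card + 2 * 2 ^ (L₁ ∩ L₂ ∩ G).card := by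
  classical
  have hG3 := (mem_planes.1 hG).2.2
  by_cases hlp : ∃ L ∈ linesOf M G, (L ∩ G).card = G.card - 1
  · obtain ⟨L, hL, hk⟩ := hlp
    exact Or.inl (demand3_eq_zero_of_line_point hG hL hk)
  · push Not at hlp
    rcases Nat.eq_or_lt_of_le hg4 with h4 | h5
    · exact Or.inl (demand3_eq_zero_of_four h4.symm)
    · have hnl : ∀ L ∈ linesOf M G, (L ∩ G).card + 2 ≤ G.card := by
        intro L hL
        have := card_inter_le_of_linesOf hG3 hL
        have := hlp L hL
        omega
      by_cases hgen : ∀ L ∈ linesOf M G, M.eRk ((G \ L : Finset α) : Set α) = 3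
      · exact Or.inr (Or.inl ⟨hgen, demand3_le_general hs hG hg4 hgen⟩)
      · push Not at hgen
        obtain ⟨L, hL, hr⟩ := hgen
        -- `Z := L ∩ G` is bad
        have hZ : L ∩ G ∈ badZ M G L := by
          unfold badZ
          rw [Finset.mem_filter, Finset.mem_powerset]
          refine ⟨Finset.Subset.refl _, (Finset.mem_filter.1 hL).2, ?_⟩
          have : G \ (L ∩ G) = G \ L := by
            ext y; simp only [Finset.mem_sdiff, Finset.mem_inter]; tauto
          rw [this]
          exact hr
        obtain ⟨L', hL', hne, hcov, -⟩ := twoLines_of_badZ hs hG hL hnl hZ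
        have h12 : TwoLines M G L L' := ⟨hL, hL', hne, hcov⟩
        exact Or.inr (Or.inr ⟨L, L', h12, h5, hnl, demand3_le_twoLines hs hG h5 hnl h12⟩)

end SixThree

end PercRepro
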